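import Literature.Computability.QuantumComplexity.PseudoBounded
import Literature.Computability.QuantumComplexity.DFKOInfluenceBoundProofs

/-!
# Route `SosSandwich`, support for `PseudoBoundedAA` (stmt-QuantumAdvantage-15237) — every fixed order is settled:
PB-AA with the DFKO rate

Tree twin of the cell node `run/shared/lean/pub/decomp-qadv/decomp-qadv-lens-5/g19/CornerDial.lean` §6 (cell
`decomp-qadv`, lens 5, gen 19): the tree theorem `dfko2007_influence_bounded_holds` (DFKO for bounded polynomials)
applied to the degree-`≤ 2T` representative `Σ_j q_j²` of a pseudo-bounded `p` gives `PseudoBoundedAA`'s exact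
quantifier shape with the rate `ε^a / 2^{2CT}` (`pbaa_expRate`), hence its conclusion with a `T₀`-dependent constant
on every finite range of orders `T ≤ T₀` (`pbaa_finiteRange`): the content of the crux is the RATE in `T` alone.
STATUS: rendered by a planner seat that could not kernel-check it (module `DFKOInfluenceBoundProofs` outside the
farm snapshot on 2026-08-31, rc 75); the hypothesis version `pbaa_expRate_of (hDFKO : DFKOShape)` with `DFKOShape`
= `dfko2007_influence_bounded` verbatim IS checked (rc 0) in the node file.
[cite: DinurEtAl2007, Thm. 3] [cite: arXiv:0911.0996, Thm. 9]
-/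

set_option linter.dupNamespace false

noncomputable section

namespace Summit.QuantumAdvantage.QuantumAdvantage.Theorems.SosSandwich

open MvPolynomial Finset
open Literature.Computability.QuantumComplexity

variable {N : ℕ}

/-- **Every fixed order is settled.** For every `p ∈ K_T` with `Var ≥ ε` some variable has influence
`≥ ε^a / 2^{C·2T}` — `PseudoBoundedAA`'s quantifier shape with the rate `exp(-O(T))` in place of `poly(1/T)`
(DFKO applied to the degree-`≤ 2T` representative `Σ_j q_j²`). [cite: DinurEtAl2007, Thm. 3] -/
theorem pbaa_expRate :
    ∃ (a C : ℕ), ∀ (N T : ℕ) (p : MvPolynomial (Fin N) ℝ) (ε : ℝ), 1 ≤ T → PseudoBounded T p →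
      0 < ε → ε ≤ boolVariance p → ∃ i : Fin N, ε ^ a / (2 : ℝ) ^ (C * (2 * T)) ≤ influence i p := by
  obtain ⟨a, C, h⟩ := dfko2007_influence_bounded_holds
  refine ⟨a, C, fun N T p ε hT hp hε hεv => ?_⟩
  obtain ⟨m, q, r, hdeg, hval⟩ := hp
  set p' : MvPolynomial (Fin N) ℝ := ∑ j, q j ^ 2 with hp'
  have hev : ∀ x, evalBool p' x = evalBool p x := by
    intro x
    unfold evalBool
    rw [hp', map_sum]
    simp only [map_pow]
    exact ((hval x).1).symm
  have hfun : evalBool p' = evalBool p := funext hev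
  have hdeg' : p'.totalDegree ≤ 2 * T := by
    rw [hp']
    refine (totalDegree_finsetSum _ _).trans (Finset.sup_le fun j _ => ?_)
    exact (totalDegree_pow _ _).trans (Nat.mul_le_mul_left 2 (hdeg j).1)
  have hbdd : ∀ x, 0 ≤ evalBool p' x ∧ evalBool p' x ≤ 1 := by
    intro x; rw [hev x]
    exact ⟨PseudoBounded.eval_nonneg ⟨m, q, r, hdeg, hval⟩ x,
      PseudoBounded.eval_le_one ⟨m, q, r, hdeg, hval⟩ x⟩
  have hvar' : ε ≤ boolVariance p' := by
    have : boolVariance p' = boolVariance p := by unfold boolVariance; rw [hfun]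
    rw [this]; exact hεv
  obtain ⟨i, hi⟩ := h N (2 * T) p' ε (by omega) hdeg' hbdd hε hvar'
  refine ⟨i, ?_⟩
  have : influence i p' = influence i p := by unfold influence; rw [hfun]
  rw [← this]; exact hi

/-- Corollary: the conclusion of `PseudoBoundedAA` at variance `≥ 1/8` holds with a `T₀`-dependent constant on
every FINITE RANGE of orders `T ≤ T₀`; only the rate as `T → ∞` is open. [cite: DinurEtAl2007, Thm. 3] -/
theorem pbaa_finiteRange (T₀ : ℕ) :
    ∃ C : ℝ, 0 < C ∧ ∀ (N T : ℕ) (p : MvPolynomial (Fin N) ℝ), 1 ≤ T → T ≤ T₀ →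
      PseudoBounded T p → 1 / 8 ≤ boolVariance p → ∃ i : Fin N, C ≤ influence i p := by
  obtain ⟨a, C, h⟩ := pbaa_expRate
  refine ⟨(1 / 8 : ℝ) ^ a / (2 : ℝ) ^ (C * (2 * T₀)), by positivity, ?_⟩
  intro N T p hT hT₀ hp hv
  obtain ⟨i, hi⟩ := h N T p (1 / 8) hT hp (by norm_num) hv
  refine ⟨i, le_trans ?_ hi⟩
  refine div_le_div_of_nonneg_left (by positivity) (by positivity) ?_
  exact pow_le_pow_right₀ (by norm_num) (Nat.mul_le_mul_left _ (by omega))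

end Summit.QuantumAdvantage.QuantumAdvantage.Theorems.SosSandwich

end
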